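import Mathlib
import HarnessLib
import Summits.Ventures.LatticeQCDFlow.Exactness.SphereLuscherSeriesLocality
import Summits.Ventures.LatticeQCDFlow.Exactness.SphereLuscherSeriesUniqueness

/-!
# The Engel–Schaefer action is a local polynomial action: its Lüscher series is local with footprint `k+1` at order `k`, and every other series agrees with it up to constants

HONEST FRAMING: exact (Metropolis-corrected) sampling algorithms for lattice gauge theory;
figures of merit are autocorrelation/cost numbers at stated couplings and volumes; no
continuum-physics claim.

Venture `LatticeQCDFlow` (cell pub-lqcd), topic `Exactness`; FANOUT row 7 (`s0-cpn-null`: the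
S0-D1 rung — 2D CP⁹, Lüscher's LO trivializing map inside HMC, Engel–Schaefer 2011).  NEW WORK of
the cell over Mathlib and the tree's `Exactness/SphereLuscherSeriesLocality.lean` (`LocalAction`,
`nball`, `exists_local_luscher_series`), `Exactness/SphereLuscherSeriesUniqueness.lean`
(`luscher_series_unique`), `Exactness/SphereLOFlowAction.lean` (`esAction`, `localField`,
`esAction_update_eq_inner` — the action is affine in each site variable) and
`Exactness/SphereTangentialLaplacian.lean` (`fderiv_inner_add_const`); nothing is cited as a fact.
Printed counterpart, NAMED ONLY: Engel–Schaefer, Comput. Phys. Commun. 182 (2011) 2107, §2 eqs.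
(6)–(7), §2.2 eq. (13), §3 eqs. (14)–(16); M. Lüscher, Commun. Math. Phys. 293 (2010) 899, §4.4–§4.5
(locality of the perturbative flow action, footprint growing linearly with the order).

## Content (`E` finite-dimensional real inner product space, `dim E ≥ 2`; `Λ` finite nonempty;
couplings `U` with no self-coupling and adjoint pairs, as in E–S)

* `couplingNbhd U n = {m | U n m ≠ 0}` — the sites coupled to `n`; `esPart κ S₀ U n` — the part
  `−κ ⟪x_n, J_n(x)⟫ + S₀/|Λ|` of the action anchored at `n` (`sum_esPart`: they sum to `esAction`);
  `esPart_mem` — it is a lattice polynomial of degree `≤ 2` supported in `nball (couplingNbhd U) 1 n`.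
* **`siteDeriv_esAction`**, **`siteEuler_esAction`** — `D_k S(x) v = −2κ ⟪J_k(x), v⟫`,
  `E_k S(x) = −2κ ⟪J_k(x), x_k⟫` (E–S eq. (13) in ambient form), hence supported in
  `nball (couplingNbhd U) 1 k`; **`esLocalAction`** — the E–S action as a `LocalAction` of degree `2`.
* **`exists_local_luscher_series_esAction`** — THE LÜSCHER SERIES OF THE LATTICE CP(N−1)/O(N)
  ACTION IS LOCAL: there are `X_n⁽ᵏ⁾`, lattice polynomials of degree `≤ 2(k+1)` depending only on
  the sites within coupling-distance `k+1` of `n`, and constants `ċ_k`, such that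
  `S̃⁽ᵏ⁾ = Σ_n X_n⁽ᵏ⁾` solves `−Σ∂̃²S̃⁽⁰⁾ = S + ċ₀`, `−Σ∂̃²S̃⁽ᵏ⁺¹⁾ = −Σ⟪∂̃S, ∂̃S̃⁽ᵏ⁾⟫ + ċ_{k+1}` on
  the product of unit spheres — the receptive field of the order-`k` perturbative trivializing
  generator `−∂̃S̃⁽ᵏ⁾` is `k+1` coupling steps, INDEPENDENTLY OF THE VOLUME `|Λ|`.
* **`luscher_series_esAction_local`** — by uniqueness, EVERY `C²` solution of the recursion for
  the E–S action is, at order `k`, such a local sum plus a constant on the spheres.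

NOT CLAIMED: anything at `t > 0` / convergence of the series; bounds on coefficients; optimality of
the radius; the `U(1)` link update; anything quantitative.
-/

noncomputable section

namespace Summit.Ventures.LatticeQCDFlow.Exactness

open Function Set NormedSpace InnerProductSpace Metric
open scoped RealInnerProductSpace ContDiff

variable {Λ : Type*} {E : Type*} [NormedAddCommGroup E] [InnerProductSpace ℝ E]

/-! ## §1 The parts of the Engel–Schaefer action and their supports -/

section Parts

variable [Fintype Λ] [DecidableEq Λ]

/-- **The sites coupled to `n`**: `couplingNbhd U n = {m | U n m ≠ 0}`. -/
def couplingNbhd (U : Λ → Λ → (E →L[ℝ] E)) (n : Λ) : Set Λ := {m | U n m ≠ 0}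

/-- **The part of the E–S action anchored at `n`**: `−κ ⟪x_n, J_n(x)⟫ + S₀/|Λ|`. -/
def esPart (κ S₀ : ℝ) (U : Λ → Λ → (E →L[ℝ] E)) (n : Λ) : (Λ → E) → ℝ := fun x =>
  -κ * ⟪x n, localField U n x⟫ + S₀ / Fintype.card Λ

variable {U : Λ → Λ → (E →L[ℝ] E)}

omit [DecidableEq Λ] in
/-- **The parts sum to the action**: `Σ_n esPart n = esAction` (`Λ` nonempty). -/
theorem sum_esPart [Nonempty Λ] (κ S₀ : ℝ) (U : Λ → Λ → (E →L[ℝ] E)) :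
    (fun x => ∑ n, esPart κ S₀ U n x) = esAction κ S₀ U := by
  funext x
  have hc : (Fintype.card Λ : ℝ) ≠ 0 := Nat.cast_ne_zero.2 Fintype.card_ne_zero
  simp only [esPart, esAction, Finset.sum_add_distrib, Finset.sum_const, Finset.card_univ,
    nsmul_eq_mul, Finset.mul_sum]
  rw [mul_div_cancel₀ _ hc]

omit [DecidableEq Λ] in
/-- The local field at `k` only sees the sites coupled to `k`. -/
theorem localField_congr {A : Set Λ} {k : Λ} (hA : couplingNbhd U k ⊆ A) {x x' : Λ → E}
    (hx : ∀ n ∈ A, x n = x' n) : localField U k x = localField U k x' := by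
  unfold localField
  refine Finset.sum_congr rfl fun m _ => ?_
  by_cases h : U k m = 0
  · rw [h]; simp
  · rw [hx m (hA h)]

omit [DecidableEq Λ] in
/-- `x ↦ ⟪J_k(x), v⟫` is supported in any set containing the sites coupled to `k`. -/
theorem inner_localField_mem_sdepOn {A : Set Λ} {k : Λ} (hA : couplingNbhd U k ⊆ A) (v : E) :
    (fun x => ⟪localField U k x, v⟫) ∈ sdepOn A :=
  fun _ _ hx => by simp only [localField_congr hA hx]

omit [DecidableEq Λ] in
/-- `x ↦ ⟪J_k(x), x_k⟫` is supported in any set containing `k` and the sites coupled to `k`. -/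
theorem inner_localField_self_mem_sdepOn {A : Set Λ} {k : Λ} (hA : couplingNbhd U k ⊆ A)
    (hk : k ∈ A) : (fun x => ⟪localField U k x, x k⟫) ∈ sdepOn A :=
  fun _ _ hx => by simp only [localField_congr hA hx, hx k hk]

variable [FiniteDimensional ℝ E]

omit [DecidableEq Λ] in
/-- **Each part is a lattice polynomial of degree `≤ 2` supported in the radius-`1` coupling ball.** -/
theorem esPart_mem (κ S₀ : ℝ) (U : Λ → Λ → (E →L[ℝ] E)) (n : Λ) :
    esPart κ S₀ U n ∈ polySD Λ E 2 (nball (couplingNbhd U) 1 n) := by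
  set b := stdOrthonormalBasis ℝ E
  constructor
  · -- polynomial of degree ≤ 2
    have e : esPart κ S₀ U n = (-κ) • (∑ m, ∑ i, (scoord ((n, i) : SiteCoord Λ E) *
        fun x : Λ → E => ⟪ContinuousLinearMap.adjoint (U n m) (b i), x m⟫)) +
          fun _ => S₀ / Fintype.card Λ := by
      funext x
      simp only [esPart, localField, Pi.add_apply, Pi.smul_apply, Finset.sum_apply, Pi.mul_apply,
        scoord, smul_eq_mul, inner_sum, ContinuousLinearMap.adjoint_inner_left]
      congr 1
      congr 1
      refine Finset.sum_congr rfl fun m _ => ?_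
      rw [← b.sum_inner_mul_inner (x n) (U n m (x m))]
      exact Finset.sum_congr rfl fun i _ => by rw [real_inner_comm (b i)]
    rw [e]
    refine Submodule.add_mem _ (Submodule.smul_mem _ _ (Submodule.sum_mem _ fun m _ =>
      Submodule.sum_mem _ fun i _ => ?_)) (const_mem_polyS 2 _)
    exact mul_mem_polyS_of_le (a := 1) (b := 1) le_rfl (scoord_mem_polyS le_rfl _)
      (slin_mem_polyS le_rfl m _)
  · -- supported in the radius-1 ball
    intro x x' hx
    simp only [esPart, localField_congr (subset_nball_one n) hx, hx n (self_mem_nball 1 n)]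

omit [FiniteDimensional ℝ E] in
/-- **E–S eq. (13) in ambient form, derivative along a fixed vector**:
`D_k S(x) v = −2κ ⟪J_k(x), v⟫` (no self-coupling, adjoint pairs). -/
theorem siteDeriv_esAction (hU0 : ∀ n, U n n = 0)
    (hUadj : ∀ m n (v w : E), ⟪U m n v, w⟫ = ⟪v, U n m w⟫) (κ S₀ : ℝ) (k : Λ) (v : E) :
    siteDeriv k v (esAction κ S₀ U) = fun x => -(2 * κ) * ⟪localField U k x, v⟫ := by
  funext x
  unfold siteDeriv
  rw [esAction_update_eq_inner hU0 hUadj κ S₀ x k, fderiv_inner_add_const]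
  simp only [innerSL_apply_apply, real_inner_smul_left]

omit [FiniteDimensional ℝ E] in
/-- **E–S eq. (13) in ambient form, Euler term**: `E_k S(x) = −2κ ⟪J_k(x), x_k⟫`. -/
theorem siteEuler_esAction (hU0 : ∀ n, U n n = 0)
    (hUadj : ∀ m n (v w : E), ⟪U m n v, w⟫ = ⟪v, U n m w⟫) (κ S₀ : ℝ) (k : Λ) :
    siteEuler k (esAction κ S₀ U) = fun x => -(2 * κ) * ⟪localField U k x, x k⟫ := by
  funext x
  show siteDeriv k (x k) (esAction κ S₀ U) x = _
  rw [siteDeriv_esAction hU0 hUadj]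

/-- **The Engel–Schaefer action as a local polynomial action** (degree `2`, coupling
neighbourhoods). -/
def esLocalAction [Nonempty Λ] (hU0 : ∀ n, U n n = 0)
    (hUadj : ∀ m n (v w : E), ⟪U m n v, w⟫ = ⟪v, U n m w⟫) (κ S₀ : ℝ) : LocalAction Λ E where
  N := couplingNbhd U
  deg := 2
  part := esPart κ S₀ U
  part_mem := esPart_mem κ S₀ U
  siteDeriv_mem k i := by
    rw [sum_esPart, siteDeriv_esAction hU0 hUadj]
    have h := inner_localField_mem_sdepOn (U := U) (subset_nball_one (N := couplingNbhd U) k)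
      (stdOrthonormalBasis ℝ E i)
    have e : (fun x => -(2 * κ) * ⟪localField U k x, stdOrthonormalBasis ℝ E i⟫) =
        (-(2 * κ)) • fun x => ⟪localField U k x, stdOrthonormalBasis ℝ E i⟫ := by
      funext x; simp
    rw [e]; exact Submodule.smul_mem _ _ h
  siteEuler_mem k := by
    rw [sum_esPart, siteEuler_esAction hU0 hUadj]
    have h := inner_localField_self_mem_sdepOn (U := U) (subset_nball_one (N := couplingNbhd U) k)
      (self_mem_nball 1 k)
    have e : (fun x => -(2 * κ) * ⟪localField U k x, x k⟫) =
        (-(2 * κ)) • fun x => ⟪localField U k x, x k⟫ := by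
      funext x; simp
    rw [e]; exact Submodule.smul_mem _ _ h

/-- The total action of `esLocalAction` is `esAction`. -/
theorem esLocalAction_action [Nonempty Λ] (hU0 : ∀ n, U n n = 0)
    (hUadj : ∀ m n (v w : E), ⟪U m n v, w⟫ = ⟪v, U n m w⟫) (κ S₀ : ℝ) :
    (esLocalAction hU0 hUadj κ S₀).action = esAction κ S₀ U :=
  sum_esPart κ S₀ U

end Parts

/-! ## §2 Locality of the Lüscher series of the Engel–Schaefer action -/

section LocalES

variable [FiniteDimensional ℝ E] [MeasurableSpace E] [BorelSpace E] [Fintype Λ] [DecidableEq Λ]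
  [Nonempty Λ] {U : Λ → Λ → (E →L[ℝ] E)}

/-- **THE LÜSCHER SERIES OF THE LATTICE CP(N−1)/O(N) ACTION IS LOCAL, FOOTPRINT `k+1` AT ORDER `k`.**
For E–S couplings (no self-coupling, adjoint pairs; `dim E ≥ 2`) there are lattice polynomials
`X_n⁽ᵏ⁾` of degree `≤ 2(k+1)`, each depending only on the sites within coupling-distance `k+1` of
its anchor `n`, and constants `ċ_k`, such that `S̃⁽ᵏ⁾ = Σ_n X_n⁽ᵏ⁾` solves Lüscher's recursion for
`S = −κ Σ_n ⟪x_n, J_n⟫ + S₀` on the product of unit spheres, at every order. -/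
theorem exists_local_luscher_series_esAction (h2 : 2 ≤ Module.finrank ℝ E) (hU0 : ∀ n, U n n = 0)
    (hUadj : ∀ m n (v w : E), ⟪U m n v, w⟫ = ⟪v, U n m w⟫) (κ S₀ : ℝ) :
    ∃ (X : ℕ → Λ → (Λ → E) → ℝ) (c : ℕ → ℝ),
      (∀ k n, X k n ∈ polySD Λ E (2 * (k + 1)) (nball (couplingNbhd U) (k + 1) n)) ∧
      (∀ ξ : Λ → sphere (0 : E) 1,
        -∑ j, siteLaplacian j (fun x => ∑ n, X 0 n x) (fun m => (ξ m : E)) =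
          esAction κ S₀ U (fun m => (ξ m : E)) + c 0) ∧
      (∀ k, ∀ ξ : Λ → sphere (0 : E) 1,
        -∑ j, siteLaplacian j (fun x => ∑ n, X (k + 1) n x) (fun m => (ξ m : E)) =
          -(∑ j, ⟪siteGrad j (esAction κ S₀ U) (fun m => (ξ m : E)),
              siteGrad j (fun x => ∑ n, X k n x) (fun m => (ξ m : E))⟫) + c (k + 1)) := by
  obtain ⟨X, c, hmem, h0, hs⟩ := exists_local_luscher_series h2 (esLocalAction hU0 hUadj κ S₀)
  rw [esLocalAction_action hU0 hUadj] at h0 hs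
  exact ⟨X, c, hmem, h0, hs⟩

/-- **EVERY LÜSCHER SERIES OF THE E–S ACTION IS LOCAL UP TO CONSTANTS**: any family of `C²`
functionals solving the recursion for `S = esAction κ S₀ U` agrees at order `k`, on the product of
unit spheres and up to an additive constant, with a sum over anchors of lattice polynomials of
degree `≤ 2(k+1)` supported in the coupling balls of radius `k+1`. -/
theorem luscher_series_esAction_local (h2 : 2 ≤ Module.finrank ℝ E) (hU0 : ∀ n, U n n = 0)
    (hUadj : ∀ m n (v w : E), ⟪U m n v, w⟫ = ⟪v, U n m w⟫) (κ S₀ : ℝ)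
    {St' : ℕ → (Λ → E) → ℝ} {c' : ℕ → ℝ} (hSt' : ∀ k, ContDiff ℝ 2 (St' k))
    (h0' : ∀ ξ : Λ → sphere (0 : E) 1,
      -∑ n, siteLaplacian n (St' 0) (fun m => (ξ m : E)) =
        esAction κ S₀ U (fun m => (ξ m : E)) + c' 0)
    (hs' : ∀ k, ∀ ξ : Λ → sphere (0 : E) 1,
      -∑ n, siteLaplacian n (St' (k + 1)) (fun m => (ξ m : E)) =
        -(∑ n, ⟪siteGrad n (esAction κ S₀ U) (fun m => (ξ m : E)),
            siteGrad n (St' k) (fun m => (ξ m : E))⟫) + c' (k + 1)) (k : ℕ) :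
    ∃ X : Λ → (Λ → E) → ℝ,
      (∀ n, X n ∈ polySD Λ E (2 * (k + 1)) (nball (couplingNbhd U) (k + 1) n)) ∧
      ∃ d : ℝ, ∀ ξ : Λ → sphere (0 : E) 1,
        St' k (fun m => (ξ m : E)) = (∑ n, X n (fun m => (ξ m : E))) + d := by
  obtain ⟨X, c, hmem, h0, hs⟩ := exists_local_luscher_series_esAction h2 hU0 hUadj κ S₀
  have hsm : ∀ k, ContDiff ℝ 2 (fun x : Λ → E => ∑ n, X k n x) := fun k =>
    ContDiff.sum fun n _ => contDiff_infty.1 (contDiff_of_mem_polyS (hmem k n).1) 2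
  obtain ⟨-, d, hd⟩ := luscher_series_unique h2 hSt' hsm h0' h0 hs' hs k
  exact ⟨X k, hmem k, d, hd⟩

end LocalES

end Summit.Ventures.LatticeQCDFlow.Exactness

end
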